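import Summits.PneNP.PneNP.Theorems.ChebyshevTracialDesignJuntaRemainderPricing
import Summits.PneNP.PneNP.Theorems.ChebyshevTracialDesignFiniteValued
import HarnessLib

/-!
# Cell pnp-psdrank, route `ChebyshevTracialDesign`: the JUNTA REMAINDER RUNG in readable form — `8^{|A|}/N^{D+1}`, psd contractions of every
# dimension (tight or not), and the balanced Chebyshev instance (crux `TracialDecayExp20`, stmt-PneNP-19878)

Brick 110c (prover g20; companion of bricks 110a `…PatternProfileSmoothness` and 110b `…JuntaRemainderPricing`, MEMO-23 §2). Brick 110b proves, for
an exact design `(n,t,T,D,B_v,C,w)`, a psd `A`-junta cut field `X` (`2|A| ≤ t+2`, `2|A|+t ≤ n+2`, no `|A| ≤ D`), any psd matching field `Y` with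
`tr(X_U Y_M) ≤ Λ_M`: `Σ_UΣ_M W·tr(X_U Y_M) ≤ B_v·C(T,D+1)·Λ̄·4^{|A|}·C(|A|,D+1)(D+1)!·N^{|A|−D−1}/[N]_{|A|}`, `N = n/2`, `Λ̄ = |PM|⁻¹Σ_M Λ_M`. HERE:
* §1 `pow_div_descFactorial_le` — `N^{x−m}/[N]_x ≤ 2^x/N^m` for `m ≤ x`, `2x ≤ N` (`[N]_x ≥ (N+1−x)^x ≥ (N/2)^x`);
  **`sum_levelWeight_trace_le_of_junta_pow`** (`4|A| ≤ n`): `≤ B_v·C(T,D+1)·Λ̄·8^{|A|}·C(|A|,D+1)(D+1)!/N^{D+1}`.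
* §2 **`value_le_of_junta_contractions`** — contraction fields `0 ⪯ X_U ⪯ I` (`A`-junta), `0 ⪯ Y_M ⪯ I` of dimension `r`, TIGHT OR NOT:
  `(Σ W·tr(X_U Y_M))/r ≤ B_v·C(T,D+1)·8^{|A|}·C(|A|,D+1)(D+1)!/N^{D+1}` — dimension-free (`tr(X_U Y_M) ≤ r`, brick `…FiniteValued.trace_mul_le_card`);
  **`sum_levelWeight_junta_le_single`** — ONE MATCHING AT A TIME: for a scalar `A`-junta `0 ≤ g ≤ Λ₀`,
  `Σ_U W(U,M)·g(U) ≤ |PM|⁻¹·B_v·C(T,D+1)·Λ₀·8^{|A|}·C(|A|,D+1)(D+1)!/N^{D+1}` at EVERY `M` — the per-matching scale of (CG_1')-type statements, continuing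
  brick 109's exact cell (`|J|+2 ≤ D`) beyond the design degree.
* §3 **`value_le_of_junta_bal`** — the route's regime: for every balanced exact design of degree `dq n` on levels `≤ Tq n` with variation `≤ B_v`
  and every `A` with `8|A| ≤ n`, junta psd contraction pairs of every dimension have normalised value
  `≤ B_v·C(Tq n, dq n + 1)·8^{|A|}·C(|A|, dq n + 1)·(dq n + 1)!/(n/2)^{dq n + 1}` — the r-free, tightness-free JUNTA REMAINDER RUNG of the crux:
  `0` for `|A| ≤ dq n` (the BC5 rung `juntaVirtualPositivity_bal`), `≈ 20·8^{|A|}(8|A|/√n)^{dq n + 1}` beyond, i.e. `n^{−(dq n+1)/4 + O(|A|/ln n)}`: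
  below `e^{−a·dq n}` for every fixed `a` once `|A| ≤ κ·dq n` (any constant `κ`, `n ≥ n₀(κ,a)`).
[cite: Rothvoss2017, §2 (PDF p. 6)] [cite: Grigoriev2001, Lemma 1.4 (PDF p. 8)] [cite: Agarwal2000DifferenceEquations, Remark 1.8.1 (1.8.8)]
[cite: CoppersmithRivlin1992, Thm. (p. 970)] [cite: GriblingDelaatLaurent2019, §5]
Stature: support/instrument (kernel lane, no defs, axioms standard). WHAT THIS IS NOT: nothing on non-junta strategies (the spread/structure part N2 of
the crux is untouched), no proof or refutation of `TracialDecayExp20`, nothing on psd rank of P_PM(K_n), no P-vs-NP content. Supports stmt-PneNP-19878.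
-/

set_option linter.dupNamespace false -- `Summit.PneNP.PneNP.…`: summit = sub-problem (D-0017)

noncomputable section

namespace Summit.PneNP.PneNP.Theorems.ChebyshevTracialDesignJuntaRemainderRung

open Finset Polynomial Literature.Barriers.PneNP
open Summit.PneNP.PneNP.Theorems.ChebyshevTracialDesignJuntaRemainderPricing (sum_levelWeight_trace_le_of_junta)
open Summit.PneNP.PneNP.Theorems.ChebyshevTracialDesignFiniteValued (trace_mul_le_card)

/-! ### §1 Readable form `8^{|A|}/N^{D+1}` -/

section Corollaries

open Matrix Literature.Combinatorics.Optimization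

variable {n : ℕ}

/-- `N^{x−m}/[N]_x ≤ 2^x/N^m` for `m ≤ x`, `2x ≤ N`, `0 < N` (since `[N]_x ≥ (N+1−x)^x ≥ (N/2)^x`). [folklore] -/
theorem pow_div_descFactorial_le {N x m : ℕ} (hN : 0 < N) (hx : 2 * x ≤ N) (hm : m ≤ x) :
    (N : ℝ) ^ (x - m) / (N.descFactorial x : ℝ) ≤ (2 : ℝ) ^ x / (N : ℝ) ^ m := by
  have hN' : (0 : ℝ) < N := by exact_mod_cast hN
  have hdesc : ((N : ℝ) / 2) ^ x ≤ (N.descFactorial x : ℝ) := by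
    have h1 : (((N + 1 - x) ^ x : ℕ) : ℝ) ≤ (N.descFactorial x : ℝ) := by exact_mod_cast Nat.pow_sub_le_descFactorial N x
    have h2 : (N : ℝ) / 2 ≤ ((N + 1 - x : ℕ) : ℝ) := by
      rw [Nat.cast_sub (by omega), Nat.cast_add, Nat.cast_one]
      have : (2 : ℝ) * x ≤ N := by exact_mod_cast hx
      linarith
    calc ((N : ℝ) / 2) ^ x ≤ (((N + 1 - x : ℕ) : ℝ)) ^ x := pow_le_pow_left₀ (by positivity) h2 x
      _ = (((N + 1 - x) ^ x : ℕ) : ℝ) := by push_cast; ring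
      _ ≤ _ := h1
  have hpos : (0 : ℝ) < ((N : ℝ) / 2) ^ x := by positivity
  calc (N : ℝ) ^ (x - m) / (N.descFactorial x : ℝ) ≤ (N : ℝ) ^ (x - m) / ((N : ℝ) / 2) ^ x :=
        div_le_div_of_nonneg_left (by positivity) hpos hdesc
    _ = (2 : ℝ) ^ x / (N : ℝ) ^ m := by
        rw [div_pow, div_div_eq_mul_div, div_eq_div_iff (by positivity) (by positivity),
          show (N : ℝ) ^ x = (N : ℝ) ^ (x - m) * (N : ℝ) ^ m by rw [← pow_add, Nat.sub_add_cancel hm]]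
        ring

/-- **JUNTA PRICING BEYOND THE DESIGN DEGREE, power form.** Under the hypotheses of brick 110b's `sum_levelWeight_trace_le_of_junta` and `4|A| ≤ n`:
`Σ_U Σ_M W(U,M)·tr(X_U Y_M) ≤ B_v·C(T,D+1)·Λ̄·8^{|A|}·C(|A|,D+1)·(D+1)!/N^{D+1}`, `N = n/2`, `Λ̄ = |PM|⁻¹Σ_M Λ_M` — zero for `|A| ≤ D`, and of size
`B_v·Λ̄·8^{|A|}·(T|A|/N)^{D+1}/(D+1)!` in general: super-polynomially small in the balanced Chebyshev regime (`T ≍ √n`, `D ≍ n^{1/4}`) for every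
junta size `|A| = O(D)`, indeed `≤ n^{−cD}` up to `|A| ≲ D·ln n/(8 ln 8)`. [cite: Rothvoss2017, §2 (PDF p. 6)] [cite: Grigoriev2001, Lemma 1.4 (PDF p. 8)]
[cite: Agarwal2000DifferenceEquations, Remark 1.8.1 (1.8.8)] -/
theorem sum_levelWeight_trace_le_of_junta_pow {t T D : ℕ} {Bv : ℝ} {C : Finset ℕ} {w : ℕ → ℝ}
    (hdes : IsExactDesign n t T D Bv C w) {r : ℕ} (A : Finset (Fin n))
    (hAt : 2 * A.card ≤ t + 2) (hAn : 2 * A.card + t ≤ n + 2) (hA4 : 4 * A.card ≤ n)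
    (X : OddSet n → Matrix (Fin r) (Fin r) ℝ) (Y : PMatch n → Matrix (Fin r) (Fin r) ℝ)
    (hX : ∀ U U' : OddSet n, U.1 ∩ A = U'.1 ∩ A → X U = X U')
    (hXpsd : ∀ U, (X U).PosSemidef) (hYpsd : ∀ M, (Y M).PosSemidef) (Λ : PMatch n → ℝ) (hΛ : ∀ U M, (X U * Y M).trace ≤ Λ M) :
    ∑ U, ∑ M, levelWeight n t C w U M * (X U * Y M).trace ≤
      Bv * ((T.choose (D + 1) : ℕ) : ℝ) * (((Fintype.card (PMatch n) : ℝ)⁻¹ * ∑ M, Λ M) * (8 : ℝ) ^ A.card *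
        (((A.card.choose (D + 1) : ℕ) : ℝ) * ((D + 1).factorial : ℝ) / (((n / 2 : ℕ) : ℝ)) ^ (D + 1))) := by
  have h := sum_levelWeight_trace_le_of_junta hdes A hAt hAn X Y hX hXpsd hYpsd Λ hΛ
  refine h.trans ?_
  -- constants are nonnegative
  have hB : 0 ≤ Bv := (sum_nonneg fun c _ => abs_nonneg (w c)).trans hdes.2.2.2.2.2.2
  have hnorm := hdes.2.2.2.2.1
  have hC := hdes.2.2.2.1
  have hCne : C.Nonempty := by
    by_contra h0
    rw [not_nonempty_iff_eq_empty] at h0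
    rw [h0, sum_empty] at hnorm
    exact zero_ne_one hnorm
  obtain ⟨c₀, hc₀⟩ := hCne
  obtain ⟨q₀, hq₀⟩ := (hC c₀ hc₀).2.2.2
  have hΛ0 : ∀ M, 0 ≤ Λ M := fun M => by
    have h0 : 0 ≤ (X q₀.1 * Y M).trace :=
      (show HasPsdFactorization (fun U M => (X U * Y M).trace) r from ⟨X, Y, hXpsd, hYpsd, fun _ _ => rfl⟩).nonneg q₀.1 M
    exact h0.trans (hΛ q₀.1 M)
  have hΛbar : 0 ≤ (Fintype.card (PMatch n) : ℝ)⁻¹ * ∑ M, Λ M :=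
    mul_nonneg (inv_nonneg.2 (Nat.cast_nonneg _)) (sum_nonneg fun M _ => hΛ0 M)
  have ht3 : 3 ≤ t := (hC c₀ hc₀).2.1.trans ((hC c₀ hc₀).2.2.1.trans hdes.2.2.1)
  have htn : 2 * t + 2 ≤ n := hdes.2.1
  have hNpos : 0 < n / 2 := by omega
  refine mul_le_mul_of_nonneg_left ?_ (by positivity)
  set Λb : ℝ := (Fintype.card (PMatch n) : ℝ)⁻¹ * ∑ M, Λ M with hΛb
  rcases le_or_gt (D + 1) A.card with hle | hlt
  · have key := pow_div_descFactorial_le hNpos (by omega) hle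
    have : (4 : ℝ) ^ A.card * (2 : ℝ) ^ A.card = (8 : ℝ) ^ A.card := by rw [← mul_pow]; norm_num
    calc Λb * (4 : ℝ) ^ A.card * (((A.card.choose (D + 1) : ℕ) : ℝ) * ((D + 1).factorial : ℝ) *
          (((n / 2 : ℕ) : ℝ)) ^ (A.card - (D + 1)) / ((n / 2).descFactorial A.card : ℝ))
        = Λb * (4 : ℝ) ^ A.card * (((A.card.choose (D + 1) : ℕ) : ℝ) * ((D + 1).factorial : ℝ)) *
            ((((n / 2 : ℕ) : ℝ)) ^ (A.card - (D + 1)) / ((n / 2).descFactorial A.card : ℝ)) := by ring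
      _ ≤ Λb * (4 : ℝ) ^ A.card * (((A.card.choose (D + 1) : ℕ) : ℝ) * ((D + 1).factorial : ℝ)) *
            ((2 : ℝ) ^ A.card / (((n / 2 : ℕ) : ℝ)) ^ (D + 1)) := mul_le_mul_of_nonneg_left key (by positivity)
      _ = Λb * (8 : ℝ) ^ A.card * (((A.card.choose (D + 1) : ℕ) : ℝ) * ((D + 1).factorial : ℝ) / (((n / 2 : ℕ) : ℝ)) ^ (D + 1)) := by
            rw [← this]; ring
  · rw [Nat.choose_eq_zero_of_lt hlt]
    simp

/-! ### §2 Psd contractions of every dimension; one matching at a time -/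

/-- **JUNTA PSD RECTANGLES OF ANY DIMENSION ARE PRICED UP TO THE REMAINDER.** For an exact design `(n, t, T, D, B_v, C, w)`, a vertex set
`A` (`2|A| ≤ t+2`, `2|A| + t ≤ n+2`, `4|A| ≤ n`), contraction fields `0 ⪯ X_U ⪯ I` (an `A`-junta) and `0 ⪯ Y_M ⪯ I` of dimension `r` — tight or not —
the normalised value satisfies `(Σ_U Σ_M W(U,M)·tr(X_U Y_M))/r ≤ B_v·C(T,D+1)·8^{|A|}·C(|A|,D+1)·(D+1)!/N^{D+1}` (`tr(X_U Y_M) ≤ r`). For `|A| ≤ D` this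
is the BC5 rung `juntaVirtualPositivity` (`≤ 0`); beyond it the dimension-free remainder. [cite: Rothvoss2017, §2 (PDF p. 6)]
[cite: Grigoriev2001, Lemma 1.4 (PDF p. 8)] [cite: GriblingDelaatLaurent2019, §5] -/
theorem value_le_of_junta_contractions {t T D : ℕ} {Bv : ℝ} {C : Finset ℕ} {w : ℕ → ℝ}
    (hdes : IsExactDesign n t T D Bv C w) {r : ℕ} (A : Finset (Fin n))
    (hAt : 2 * A.card ≤ t + 2) (hAn : 2 * A.card + t ≤ n + 2) (hA4 : 4 * A.card ≤ n)
    (X : OddSet n → Matrix (Fin r) (Fin r) ℝ) (Y : PMatch n → Matrix (Fin r) (Fin r) ℝ)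
    (hX : ∀ U U' : OddSet n, U.1 ∩ A = U'.1 ∩ A → X U = X U')
    (hXc : ∀ U, (X U).PosSemidef ∧ (1 - X U).PosSemidef) (hYc : ∀ M, (Y M).PosSemidef ∧ (1 - Y M).PosSemidef) :
    (∑ U, ∑ M, levelWeight n t C w U M * (X U * Y M).trace) / r ≤
      Bv * ((T.choose (D + 1) : ℕ) : ℝ) * ((8 : ℝ) ^ A.card *
        (((A.card.choose (D + 1) : ℕ) : ℝ) * ((D + 1).factorial : ℝ) / (((n / 2 : ℕ) : ℝ)) ^ (D + 1))) := by
  have h := sum_levelWeight_trace_le_of_junta_pow hdes A hAt hAn hA4 X Y hX (fun U => (hXc U).1) (fun M => (hYc M).1)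
    (fun _ => (r : ℝ)) (fun U M => trace_mul_le_card (hXc U).2 (hYc M).1 (hYc M).2)
  have hB : 0 ≤ Bv := (sum_nonneg fun c _ => abs_nonneg (w c)).trans hdes.2.2.2.2.2.2
  have havg : (Fintype.card (PMatch n) : ℝ)⁻¹ * ∑ _M : PMatch n, (r : ℝ) ≤ r := by
    rw [sum_const, card_univ, nsmul_eq_mul]
    rcases eq_or_ne (Fintype.card (PMatch n) : ℝ) 0 with h0 | h0
    · rw [h0]; simp
    · rw [← mul_assoc, inv_mul_cancel₀ h0, one_mul]
  have h' : ∑ U, ∑ M, levelWeight n t C w U M * (X U * Y M).trace ≤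
      Bv * ((T.choose (D + 1) : ℕ) : ℝ) * ((r : ℝ) * (8 : ℝ) ^ A.card *
        (((A.card.choose (D + 1) : ℕ) : ℝ) * ((D + 1).factorial : ℝ) / (((n / 2 : ℕ) : ℝ)) ^ (D + 1))) :=
    h.trans (mul_le_mul_of_nonneg_left (mul_le_mul_of_nonneg_right (mul_le_mul_of_nonneg_right havg (by positivity)) (by positivity))
      (by positivity))
  rcases Nat.eq_zero_or_pos r with hr | hr
  · subst hr
    simp only [Nat.cast_zero, div_zero]
    positivity
  · have hr' : (0 : ℝ) < r := by exact_mod_cast hr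
    rw [div_le_iff₀ hr']
    refine h'.trans (le_of_eq ?_)
    ring

/-- **ONE MATCHING AT A TIME.** For an exact design `(n, t, T, D, B_v, C, w)`, a perfect matching `M`, a vertex set `A` (`2|A| ≤ t+2`, `2|A|+t ≤ n+2`,
`4|A| ≤ n`) and a scalar cut function `0 ≤ g ≤ Λ₀` depending only on `U ∩ A`:
`Σ_U W(U,M)·g(U) ≤ |PM|⁻¹·B_v·C(T,D+1)·Λ₀·8^{|A|}·C(|A|,D+1)·(D+1)!/N^{D+1}` — the per-matching form consumed by (CG_1')-type statements (brick 109's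
exact cell `|J| + 2 ≤ D` continues beyond the design degree with this remainder). [cite: Rothvoss2017, §2 (PDF p. 6)]
[cite: Grigoriev2001, Lemma 1.4 (PDF p. 8)] [cite: Agarwal2000DifferenceEquations, Remark 1.8.1 (1.8.8)] -/
theorem sum_levelWeight_junta_le_single {t T D : ℕ} {Bv : ℝ} {C : Finset ℕ} {w : ℕ → ℝ}
    (hdes : IsExactDesign n t T D Bv C w) (M : PMatch n) (A : Finset (Fin n))
    (hAt : 2 * A.card ≤ t + 2) (hAn : 2 * A.card + t ≤ n + 2) (hA4 : 4 * A.card ≤ n)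
    (g : OddSet n → ℝ) (hg : ∀ U U' : OddSet n, U.1 ∩ A = U'.1 ∩ A → g U = g U') (hg0 : ∀ U, 0 ≤ g U) {Λ₀ : ℝ} (hgΛ : ∀ U, g U ≤ Λ₀) :
    ∑ U, levelWeight n t C w U M * g U ≤
      (Fintype.card (PMatch n) : ℝ)⁻¹ * (Bv * ((T.choose (D + 1) : ℕ) : ℝ) * (Λ₀ * (8 : ℝ) ^ A.card *
        (((A.card.choose (D + 1) : ℕ) : ℝ) * ((D + 1).factorial : ℝ) / (((n / 2 : ℕ) : ℝ)) ^ (D + 1)))) := by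
  classical
  set X : OddSet n → Matrix (Fin 1) (Fin 1) ℝ := fun U => g U • (1 : Matrix (Fin 1) (Fin 1) ℝ) with hX
  set Y : PMatch n → Matrix (Fin 1) (Fin 1) ℝ := fun M' => if M' = M then 1 else 0 with hY
  have htr : ∀ U M', (X U * Y M').trace = if M' = M then g U else 0 := fun U M' => by
    rw [hX, hY]; dsimp only
    split_ifs
    · rw [Matrix.mul_one, Matrix.trace_smul, Matrix.trace_one, Fintype.card_fin, Nat.cast_one, smul_eq_mul, mul_one]
    · rw [Matrix.mul_zero, Matrix.trace_zero]
  have h := sum_levelWeight_trace_le_of_junta_pow hdes A hAt hAn hA4 X Y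
    (fun U U' hUU' => by rw [hX]; dsimp only; rw [hg U U' hUU'])
    (fun U => Matrix.PosSemidef.one.smul (hg0 U))
    (fun M' => by rw [hY]; dsimp only; split_ifs; exacts [Matrix.PosSemidef.one, Matrix.PosSemidef.zero])
    (fun M' => if M' = M then Λ₀ else 0)
    (fun U M' => by rw [htr]; split_ifs; exacts [hgΛ U, le_refl _])
  have hlhs : ∑ U, ∑ M', levelWeight n t C w U M' * (X U * Y M').trace = ∑ U, levelWeight n t C w U M * g U := by
    refine Fintype.sum_congr _ _ fun U => ?_
    simp_rw [htr, mul_ite, mul_zero]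
    rw [Finset.sum_ite_eq' univ M, if_pos (mem_univ _)]
  have havg : ∑ M' : PMatch n, (if M' = M then Λ₀ else 0) = Λ₀ := by rw [Finset.sum_ite_eq' univ M, if_pos (mem_univ _)]
  rw [hlhs, havg] at h
  refine h.trans (le_of_eq ?_)
  ring

end Corollaries

/-! ### §3 The balanced Chebyshev instance -/

section Balanced

open Matrix Literature.Combinatorics.Optimization

variable {n : ℕ}

/-- **THE JUNTA REMAINDER RUNG OF THE CRUX.** For every balanced exact design of degree `dq n` on levels `≤ Tq n` (variation `≤ B_v`), every vertex
set `A` with `8|A| ≤ n`, and all contraction fields `0 ⪯ X_U ⪯ I` (depending only on `U ∩ A`) and `0 ⪯ Y_M ⪯ I` of any dimension `r`, tight or not: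
`(Σ_UΣ_M W(U,M)·tr(X_U Y_M))/r ≤ B_v·C(Tq n, dq n + 1)·8^{|A|}·C(|A|, dq n + 1)·(dq n + 1)!/(n/2)^{dq n + 1}`.
[cite: Rothvoss2017, §2 (PDF p. 6)] [cite: Grigoriev2001, Lemma 1.4 (PDF p. 8)] [cite: GriblingDelaatLaurent2019, §5] -/
theorem value_le_of_junta_bal {t : ℕ} {Bv : ℝ} {C : Finset ℕ} {w : ℕ → ℝ}
    (hdes : IsBalancedDesign n t (Tq n) (dq n) Bv C w) {r : ℕ} (A : Finset (Fin n)) (hA8 : 8 * A.card ≤ n)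
    (X : OddSet n → Matrix (Fin r) (Fin r) ℝ) (Y : PMatch n → Matrix (Fin r) (Fin r) ℝ)
    (hX : ∀ U U' : OddSet n, U.1 ∩ A = U'.1 ∩ A → X U = X U')
    (hXc : ∀ U, (X U).PosSemidef ∧ (1 - X U).PosSemidef) (hYc : ∀ M, (Y M).PosSemidef ∧ (1 - Y M).PosSemidef) :
    (∑ U, ∑ M, levelWeight n t C w U M * (X U * Y M).trace) / r ≤
      Bv * (((Tq n).choose (dq n + 1) : ℕ) : ℝ) * ((8 : ℝ) ^ A.card *
        (((A.card.choose (dq n + 1) : ℕ) : ℝ) * ((dq n + 1).factorial : ℝ) / (((n / 2 : ℕ) : ℝ)) ^ (dq n + 1))) := by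
  have hbal : n ≤ 4 * t := hdes.2
  have htn : 2 * t + 2 ≤ n := hdes.1.2.1
  exact value_le_of_junta_contractions hdes.1 A (by omega) (by omega) (by omega) X Y hX hXc hYc

end Balanced

end Summit.PneNP.PneNP.Theorems.ChebyshevTracialDesignJuntaRemainderRung
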